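import Summits.QuantumFields.YangMills.Theorems.BalabanUVNodesN13U1StepMajorantTowerAtRecord13CoPH

/-!
# BalabanUVNodes ∕ N13 — THE k → k+1 STEP OF THE COR-3 UPPER LEAF IN THE (0.2) [IV] LAST-REGION CURRENCY AT NODE 00's STAGE-13 RECORD: THE PIECE STEP AT
# THE ₁₃ PLUGS, THE NEW-PAIR REGROUPING `Σ_{s′ : Λ_{k+1}(s′)ᶜ = Z′} = Σ_s Σ_{(Ω_{k+1}, Λ_{k+1}) : Λ_{k+1} = Z′ᶜ}`, AND THE `Ω_{k+1}`-COUNT AT FIXED LAST REGION (Track A,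
# DAG node N13 = [B16]; cluster K1 — K1⁷ `StabilityBAtRecordR13SepCoPH` = stmt-QuantumFields-20542, helper; seat `pub-ymgap-dag-n13-w6` g2 on the in-row HAND-OUT of
# `pub-ymgap-dag-n13-w3` g3 («the (0.2)-currency piece step at the ₁₃ plugs + new-pair regrouping + count»); 2026-08-28; count-neutral)

HONEST FRAMING.  Count-neutral kernel BOOKKEEPING + [folklore] finite combinatorics; nothing of Bałaban's is asserted.  dag-n13-w3's
`…N13U1StepMajorantTowerAtRecord13CoPH` (S1) carved the upper leaf (U1) of [III] Cor. 3 along the slot recursion of the represented tower of record and proved THE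
(0.2)-CURRENCY PIECE STEP `abs_pieceOfRecord_succ_le`: the level-(k+1) piece `ρ_{k+1}(Z′,·)` with last large-field region `Z′` is bounded by the sum, over the level-(k+1)
histories `s′` with `Λ_{k+1}(s′)ᶜ = Z′`, of the transported step-weighted level-`k` majorant times the 𝐑-ratio modulus.  THIS FILE (i) instantiates that step at K1⁷'s Stage-13
record with def-T's step provisos FROM `Provisos₁₃CoPH` discharging the `w`-rows (`h.tstep`: `measW` ∕ `absW_le`, the pattern of S1 §3); (ii) RE-INDEXES the sum over `s′`
with prescribed last region as a sum over the level-`k` histories `s` and the NEW ADMISSIBLE PAIRS `(Ω_{k+1}, Λ_{k+1})` after `s` with `Λ_{k+1} = Z′ᶜ` (n22-b's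
`Seq.sum_seq_succ` ∕ `snoc_Λ_succ` ∕ `init_snoc` BY NAME — [III] p. 267 *«a sum over admissible domains Ω_{k+1}»*, p. 270 *«a sum over domains Λ_{k+1}»*); (iii) under a
PRODUCT-SHAPE NEW-PAIR ROW «summand(s.snoc e)(V′) ≤ B(s)·x^{#𝐃_{k+1}-cubes ⊄ Ω_{k+1}}·y^{#𝐃_{k+1}-cubes ⊄ Λ_{k+1}}» (`x, y ≥ 0`, `B ≥ 0` a level-`k` TOTAL-MASS letter) COUNTS
the new domain `Ω_{k+1} ∈ 𝐃_{k+1}` at fixed `Λ_{k+1} = Z′ᶜ` by dag-n13-w3's F1 `classSum_pow_lf_le_exp` (`Σ_Ω x^{#⊄Ω} ≤ (1+x)^{|I_{k+1}|} ≤ exp(x|I_{k+1}|)`; the pairs with a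
fixed second domain inject into `𝐃_{k+1}` by their first domain), whence (U1_Z) AT LEVEL k+1: `|ρ_{k+1}(Z′,V′)| ≤ (Σ_s B(s))·exp(x|I_{k+1}|)·y^{#𝐃_{k+1}-cubes ⊄ Z′ᶜ}` — the
level-(k+1) per-last-region majorant from a level-`k` total majorant mass + per-new-pair rows — which FEEDS F1's `densOfRecord₁₃_le_of_pieceBound` (the upper half of (0.1) at
level `k+1`, combinatorial leaf proved there): `ρ_{k+1}(V′) ≤ exp(E₊|T₁^{(k+1)}|)` once `(Σ_s B s)·exp(x|I_{k+1}|) ≤ e^{a}` and `a + y|I_{k+1}| ≤ E₊|T₁^{(k+1)}|`.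
WHAT IS DISPLAYED (LOCATED, nobody's theorem here): the new-pair row IS Bałaban's [III] §3 ∕ (2.49) ∕ [IV] §1 ∕ [B16] (1.89) analysis of ONE renormalization step (the transported
step weight × 𝐑-ratio modulus pays the new step's small factors per new large-field cube); the TOTAL-MASS letter `B` is where the (0.2) currency differs from the full-history
currency of F2 (there `Σ_s B(s)` is itself counted by a product over ALL earlier steps, `sum_historyMajorant₁₃_le_exp`, with the located early-step demand `x_j + y_j ≲ L^{−4(k−j)}`;
here it is ONE number per level, to be met by whatever level-`k` information the consumer holds).  (U1) NOT proved; [III] Cor. 3 NOT proved; N13 NOT discharged; K0⁷ ∕ K1⁷ NOT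
closed; counts unmoved (discharged 5∕27 · Track A 5∕28).  ONE finite four-torus programme at fixed `ε = L^{−K}`; R4 closes the conditional finite-𝕋⁴ rung `BalabanLadder.UV` only —
the Yang–Mills mass gap (Clay) is NOT proved by any of this; nothing continuum ∕ ℝ⁴ ∕ OS.  No `sorry`, `def`, `instance`, `notation`.

WHAT THIS FILE PROVES.
§1 [folklore] over r11's (2.18) index: `sum_filter_lastRegion_eq_sum_extPair` (the NEW-PAIR REGROUPING at prescribed last region), `sum_extPair_lastRegion_pow_lf_le_exp` (the
   `Ω_{k+1}`-COUNT at fixed `Λ_{k+1}`).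
§2 generic over the represented tower of record (S1 §2's letters): `abs_pieceOfRecord_succ_le_sum_extPair` (S1's piece step, regrouped), ★★ `abs_pieceOfRecord_succ_le_of_totalMass_of_newPairRow`
   ((U1_Z) at level k+1 from a level-k total majorant mass + the product-shape new-pair row).
§3 at K1⁷'s record: ★ `abs_pieceOfRecord₁₃_succ_le` (S1's piece step at the ₁₃ plugs, `w`-rows from `Provisos₁₃CoPH.tstep`), `abs_pieceOfRecord₁₃_succ_le_sum_extPair`,
   ★★★ `abs_pieceOfRecord₁₃_succ_le_of_totalMass_of_newPairRow` ((U1_Z) at level k+1 at the record), ★★★ `densOfRecord₁₃_succ_le_of_totalMass_of_newPairRow` (fed to F1's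
   `densOfRecord₁₃_le_of_pieceBound`: the upper half of (0.1) at level k+1).

Sources: [Balaban1988Convergent] (2.1) p.254, (2.18) p.257, (2.49) + Cor. 3 (2.50) p.264, (3.1) p.264, §3 p.267, (3.24)–(3.25) p.270; [Balaban1989LargeFieldI] (0.1) p.175,
(0.2)–(0.3) p.176; [Balaban1989LargeFieldII] Thm 1 + (0.1) pp.355–356, (1.89) p.387; [Balaban1982Higgs2] (3.46) p.593 (cite only: the binomial count).
-/

noncomputable section

open MeasureTheory
open scoped BigOperators

namespace Summit.QuantumFields.YangMills.BalabanUVNodes.N13U1StepPieceCountAtRecord13CoPH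

open Literature.MathematicalPhysics.QuantumFieldTheory.Balaban1983to89
open T4Continuum Node00 B14.Eq218Concrete
open Summit.QuantumFields.YangMills.BalabanUVNodes.N13Cor3LastRegionCountAtRecord13CoPH
  (classSum_pow_lf_le_exp densOfRecord₁₃_le_of_pieceBound)
open Summit.QuantumFields.YangMills.BalabanUVNodes.N13U1StepMajorantTowerAtRecord13CoPH
  (abs_pieceOfRecord_succ_le)

/-! ## §1. The new-pair regrouping at prescribed last region, and the `Ω_{k+1}`-count at fixed `Λ_{k+1}` [folklore] -/

section Regrouping

variable {α : Type*} {D : ℕ → Set (Set α)} {k : ℕ}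

open Classical in
/-- **THE NEW-PAIR REGROUPING AT PRESCRIBED LAST REGION** [folklore]: a sum over the admissible sequences `s′` of length `k + 1` whose last small-field domain has complement
`Λ_{k+1}(s′)ᶜ = Z` is the sum over the admissible sequences `s` of length `k` of the sum over the new admissible pairs `e = (Ω_{k+1}, Λ_{k+1})` after `s` with `Λ_{k+1}ᶜ = Z`
(n22-b's `Seq.sum_seq_succ` + `snoc_Λ_succ`; the `Fintype` structures on the pairs are an instance BINDER, dischargeable by `Seq.extPairFintype`).
[cite: Balaban1988Convergent, (2.18) p.257, §3 p.267, p.270 (bookkeeping); Balaban1989LargeFieldI, (0.2) p.176] -/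
theorem sum_filter_lastRegion_eq_sum_extPair [Finite α] [∀ s : Seq D k, Fintype (Seq.ExtPair D k s)] {M : Type*} [AddCommMonoid M]
    (f : Seq D (k + 1) → M) (Z : Set α) :
    ∑ s' ∈ Finset.univ.filter (fun s' : Seq D (k + 1) => (s'.Λ (k + 1))ᶜ = Z), f s'
      = ∑ s : Seq D k, ∑ e ∈ Finset.univ.filter (fun e : Seq.ExtPair D k s => (e.1.2)ᶜ = Z), f (s.snoc e) := by
  rw [Finset.sum_filter, Seq.sum_seq_succ]
  refine Finset.sum_congr rfl fun s _ => ?_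
  rw [Finset.sum_filter]
  refine Finset.sum_congr rfl fun e _ => ?_
  rw [Seq.snoc_Λ_succ]

open Classical in
/-- **THE `Ω_{k+1}`-COUNT AT FIXED LAST REGION** [folklore]: if the class `𝐃_{k+1}` consists of unions of cubes of a finite family `I` and `x ≥ 0`, then over the new admissible
pairs `e = (Ω_{k+1}, Λ_{k+1})` after `s` with PRESCRIBED `Λ_{k+1}ᶜ = Z`, `Σ_e x^{#I-cubes ⊄ Ω_{k+1}(e)} ≤ exp(x·|I|)`: such pairs are determined by their first domain, which lies in
`𝐃_{k+1}`, so the sum injects into the class count `classSum_pow_lf_le_exp` ([6] (3.46)'s binomial count in [III]'s letters).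
[cite: Balaban1988Convergent, §3 p.267 («a sum over admissible domains Ω_{k+1}»); Balaban1982Higgs2, (3.46) p.593 (cite only)] -/
theorem sum_extPair_lastRegion_pow_lf_le_exp {ι : Type*} (s : Seq D k) [Fintype (Seq.ExtPair D k s)] (I : Finset ι) (cube : ι → Set α)
    (hD : ∀ S ∈ D (k + 1), ∃ A : Finset ι, A ⊆ I ∧ S = ⋃ a ∈ A, cube a) {x : ℝ} (hx : 0 ≤ x) (Z : Set α) :
    ∑ e ∈ Finset.univ.filter (fun e : Seq.ExtPair D k s => (e.1.2)ᶜ = Z), x ^ Set.ncard {c | c ∈ I ∧ ¬ cube c ⊆ e.1.1}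
      ≤ Real.exp (x * I.card) := by
  -- the pairs with prescribed second domain are determined by their first domain
  have hinj : Set.InjOn (fun e : Seq.ExtPair D k s => e.1.1)
      ↑(Finset.univ.filter (fun e : Seq.ExtPair D k s => (e.1.2)ᶜ = Z)) := by
    intro e he e' he' h
    rw [Finset.coe_filter] at he he'
    have h2 : e.1.2 = e'.1.2 := compl_injective (he.2.trans he'.2.symm)
    exact Subtype.ext (Prod.ext h h2)
  rw [← Finset.sum_image (f := fun S : Set α => x ^ Set.ncard {c | c ∈ I ∧ ¬ cube c ⊆ S}) hinj]
  refine classSum_pow_lf_le_exp I cube _ (fun S hS => ?_) hx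
  rw [Finset.mem_image] at hS
  obtain ⟨e, -, rfl⟩ := hS
  exact hD e.1.1 e.2.1

end Regrouping

/-! ## §2. GENERIC OVER THE REPRESENTED TOWER OF RECORD: S1's piece step regrouped by new pairs, and (U1_Z) at level k+1 from a total mass + the new-pair row -/

section Tower

variable (F : T4Family) (N : ℕ) [NeZero N] (ν : Stage7Numerics) (τ : TowerNumerics)
variable (E : B12.RunParams → ℝ) (w : StepWeightsOfRecord F N ν τ.M) (ppSel : PpSelOfRecord F ν τ.M) (p : B12.RunParams) (g : ℕ → ℝ)

open Classical in
/-- **S1's (0.2)-CURRENCY PIECE STEP, REGROUPED BY NEW PAIRS**: under S1's hypotheses (a bounded measurable level-`k` majorant `M(s)` of the history terms, the `w`-rows, the 𝐑-ratio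
row with modulus `c_R ≥ 0`), `|ρ_{k+1}(Z′,V′)| ≤ Σ_s Σ_{e : Λ_{k+1}(e)ᶜ = Z′} χ_{k+1}(s.snoc e)(V′)·c_R(s.snoc e)(V′)·T_k(|w_k(s.snoc e)(·,V′)|·M(s))(V′)` — the per-step integrals
indexed by the OLD history `s` and the NEW pair `e` (`abs_pieceOfRecord_succ_le` + `sum_filter_lastRegion_eq_sum_extPair` + `Seq.init_snoc`).  Nothing of Bałaban's asserted.
[cite: Balaban1989LargeFieldI, (0.2)–(0.3) p.176; Balaban1988Convergent, (3.1) p.264, §3 p.267, p.270] -/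
theorem abs_pieceOfRecord_succ_le_sum_extPair (k : ℕ) (Z' : Set (Site (F.P p.K) 0)) (V' : GaugeField (F.P p.K) (k + 1) (SU N))
    [∀ s : SeqOfRecord F ν τ.M g p.K k, Fintype (Seq.ExtPair (DOfRecord F ν τ.M g p.K) k s)]
    (M : SeqOfRecord F ν τ.M g p.K k → GaugeField (F.P p.K) k (SU N) → ℝ)
    (cR : SeqOfRecord F ν τ.M g p.K (k + 1) → GaugeField (F.P p.K) (k + 1) (SU N) → ℝ)
    (hM : ∀ s U, |chiSeqOfRecord F N ν τ.M g p.K k s U * slotsOfRecord F N ν τ E w ppSel p g k s U| ≤ M s U)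
    (hMm : ∀ s, Measurable (M s)) (hMC : ∀ s, ∃ C : ℝ, ∀ U, M s U ≤ C)
    (hw : ∀ s' : SeqOfRecord F ν τ.M g p.K (k + 1), Measurable fun U : GaugeField (F.P p.K) k (SU N) => w p g k s' U V')
    (hwb : ∀ (s' : SeqOfRecord F ν τ.M g p.K (k + 1)) U, |w p g k s' U V'| ≤ 1)
    (hcR : ∀ s', 0 ≤ cR s' V')
    (hR : ∀ s', |slotsOfRecord F N ν τ E w ppSel p g (k + 1) s' V'| ≤ cR s' V' * |slotsTOfRecord F N ν τ E w ppSel p g (k + 1) s' V'|) :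
    |pieceOfRecord F N ν τ.M (slotsOfRecord F N ν τ E w ppSel) p g (k + 1) Z' V'|
      ≤ ∑ s : SeqOfRecord F ν τ.M g p.K k, ∑ e ∈ Finset.univ.filter
          (fun e : Seq.ExtPair (DOfRecord F ν τ.M g p.K) k s => (e.1.2)ᶜ = Z'),
          chiSeqOfRecord F N ν τ.M g p.K (k + 1) (s.snoc e) V' * cR (s.snoc e) V' *
            transportOfRecord F N p.K k (fun U => |w p g k (s.snoc e) U V'| * M s U) V' := by
  refine (abs_pieceOfRecord_succ_le F N ν τ E w ppSel p g k Z' V' M cR hM hMm hMC hw hwb hcR hR).trans (le_of_eq ?_)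
  rw [sum_filter_lastRegion_eq_sum_extPair]
  refine Finset.sum_congr rfl fun s _ => Finset.sum_congr rfl fun e _ => ?_
  simp only [Seq.init_snoc]

open Classical in
/-- **★★ (U1_Z) AT LEVEL k+1 FROM A LEVEL-k TOTAL MAJORANT MASS + THE PRODUCT-SHAPE NEW-PAIR ROW** [PROVED bookkeeping]: let `M(s)` be a bounded measurable majorant of the
level-`k` history terms (S1's letters) and suppose the NEW-PAIR ROW «for every old history `s` and every new admissible pair `e = (Ω_{k+1}, Λ_{k+1})`,
`χ_{k+1}(s.snoc e)(V′)·c_R(s.snoc e)(V′)·T_k(|w_k(s.snoc e)(·,V′)|·M(s))(V′) ≤ B(s)·x^{#𝐃_{k+1}-cubes ⊄ Ω_{k+1}}·y^{#𝐃_{k+1}-cubes ⊄ Λ_{k+1}}`» with `x, y ≥ 0` and a non-negative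
TOTAL-MASS letter `B(s)`.  Then `|ρ_{k+1}(Z′,V′)| ≤ (Σ_s B(s))·exp(x·|I_{k+1}|)·y^{#𝐃_{k+1}-cubes ⊄ Z′ᶜ}` — at fixed last region `Λ_{k+1} = Z′ᶜ` the `y`-factor is constant and the
`Ω_{k+1}`-sum is the class count (`sum_extPair_lastRegion_pow_lf_le_exp` at `𝐃_{k+1} = unionsOfCubes`).  The new-pair row is the DISPLAYED analytic content ([III] §3 ∕ (2.49),
[IV] §1, [B16] (1.89)) — LOCATED, nobody's theorem here; nothing of Bałaban's asserted. [cite: Balaban1989LargeFieldI, (0.2)–(0.3) p.176; Balaban1988Convergent, (2.49) p.264, §3 p.267, (3.25) p.270; Balaban1989LargeFieldII, (1.89) p.387] -/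
theorem abs_pieceOfRecord_succ_le_of_totalMass_of_newPairRow (k : ℕ) (Z' : Set (Site (F.P p.K) 0)) (V' : GaugeField (F.P p.K) (k + 1) (SU N))
    (M : SeqOfRecord F ν τ.M g p.K k → GaugeField (F.P p.K) k (SU N) → ℝ)
    (cR : SeqOfRecord F ν τ.M g p.K (k + 1) → GaugeField (F.P p.K) (k + 1) (SU N) → ℝ)
    (hM : ∀ s U, |chiSeqOfRecord F N ν τ.M g p.K k s U * slotsOfRecord F N ν τ E w ppSel p g k s U| ≤ M s U)
    (hMm : ∀ s, Measurable (M s)) (hMC : ∀ s, ∃ C : ℝ, ∀ U, M s U ≤ C)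
    (hw : ∀ s' : SeqOfRecord F ν τ.M g p.K (k + 1), Measurable fun U : GaugeField (F.P p.K) k (SU N) => w p g k s' U V')
    (hwb : ∀ (s' : SeqOfRecord F ν τ.M g p.K (k + 1)) U, |w p g k s' U V'| ≤ 1)
    (hcR : ∀ s', 0 ≤ cR s' V')
    (hR : ∀ s', |slotsOfRecord F N ν τ E w ppSel p g (k + 1) s' V'| ≤ cR s' V' * |slotsTOfRecord F N ν τ E w ppSel p g (k + 1) s' V'|)
    (B : SeqOfRecord F ν τ.M g p.K k → ℝ) (hB : ∀ s, 0 ≤ B s) {x y : ℝ} (hx : 0 ≤ x) (hy : 0 ≤ y)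
    (hrow : ∀ (s : SeqOfRecord F ν τ.M g p.K k) (e : Seq.ExtPair (DOfRecord F ν τ.M g p.K) k s),
      chiSeqOfRecord F N ν τ.M g p.K (k + 1) (s.snoc e) V' * cR (s.snoc e) V' *
          transportOfRecord F N p.K k (fun U => |w p g k (s.snoc e) U V'| * M s U) V' ≤
        B s * (x ^ Set.ncard {c | c ∈ cubeIndices (F.P p.K) (dCubeSide (F.P p.K).L τ.M (RkOfRecord (F.P p.K).L ν.r (g (k + 1))) (k + 1)) ∧
              ¬ cubeEnl (F.P p.K) (dCubeSide (F.P p.K).L τ.M (RkOfRecord (F.P p.K).L ν.r (g (k + 1))) (k + 1)) c 0 ⊆ e.1.1} *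
            y ^ Set.ncard {c | c ∈ cubeIndices (F.P p.K) (dCubeSide (F.P p.K).L τ.M (RkOfRecord (F.P p.K).L ν.r (g (k + 1))) (k + 1)) ∧
              ¬ cubeEnl (F.P p.K) (dCubeSide (F.P p.K).L τ.M (RkOfRecord (F.P p.K).L ν.r (g (k + 1))) (k + 1)) c 0 ⊆ e.1.2})) :
    |pieceOfRecord F N ν τ.M (slotsOfRecord F N ν τ E w ppSel) p g (k + 1) Z' V'|
      ≤ (∑ s : SeqOfRecord F ν τ.M g p.K k, B s) *
          Real.exp (x * (cubeIndices (F.P p.K) (dCubeSide (F.P p.K).L τ.M (RkOfRecord (F.P p.K).L ν.r (g (k + 1))) (k + 1))).card) *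
          y ^ Set.ncard {c | c ∈ cubeIndices (F.P p.K) (dCubeSide (F.P p.K).L τ.M (RkOfRecord (F.P p.K).L ν.r (g (k + 1))) (k + 1)) ∧
              ¬ cubeEnl (F.P p.K) (dCubeSide (F.P p.K).L τ.M (RkOfRecord (F.P p.K).L ν.r (g (k + 1))) (k + 1)) c 0 ⊆ Z'ᶜ} := by
  letI : ∀ s : SeqOfRecord F ν τ.M g p.K k, Fintype (Seq.ExtPair (DOfRecord F ν τ.M g p.K) k s) := fun s => Seq.extPairFintype s
  -- local letters: the cube family `I`, the cubes, the large-field exponents `nlf S = #{c ∈ I | cube c ⊄ S}`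
  set I := cubeIndices (F.P p.K) (dCubeSide (F.P p.K).L τ.M (RkOfRecord (F.P p.K).L ν.r (g (k + 1))) (k + 1)) with hI
  set cube := fun c : B14DomainGeom.Pt (F.P p.K).d =>
    cubeEnl (F.P p.K) (dCubeSide (F.P p.K).L τ.M (RkOfRecord (F.P p.K).L ν.r (g (k + 1))) (k + 1)) c 0 with hcube
  have hcount : ∀ s : SeqOfRecord F ν τ.M g p.K k,
      ∑ e ∈ Finset.univ.filter (fun e : Seq.ExtPair (DOfRecord F ν τ.M g p.K) k s => (e.1.2)ᶜ = Z'),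
          x ^ Set.ncard {c | c ∈ I ∧ ¬ cube c ⊆ e.1.1} ≤ Real.exp (x * I.card) := fun s =>
    sum_extPair_lastRegion_pow_lf_le_exp s I cube (fun S hS => (mem_unionsOfCubes_iff _ _ S).1 hS) hx Z'
  have hyZ : 0 ≤ y ^ Set.ncard {c | c ∈ I ∧ ¬ cube c ⊆ Z'ᶜ} := pow_nonneg hy _
  calc |pieceOfRecord F N ν τ.M (slotsOfRecord F N ν τ E w ppSel) p g (k + 1) Z' V'|
      ≤ ∑ s : SeqOfRecord F ν τ.M g p.K k, ∑ e ∈ Finset.univ.filter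
          (fun e : Seq.ExtPair (DOfRecord F ν τ.M g p.K) k s => (e.1.2)ᶜ = Z'),
          chiSeqOfRecord F N ν τ.M g p.K (k + 1) (s.snoc e) V' * cR (s.snoc e) V' *
            transportOfRecord F N p.K k (fun U => |w p g k (s.snoc e) U V'| * M s U) V' :=
        abs_pieceOfRecord_succ_le_sum_extPair F N ν τ E w ppSel p g k Z' V' M cR hM hMm hMC hw hwb hcR hR
    _ ≤ ∑ s : SeqOfRecord F ν τ.M g p.K k, ∑ e ∈ Finset.univ.filter
          (fun e : Seq.ExtPair (DOfRecord F ν τ.M g p.K) k s => (e.1.2)ᶜ = Z'),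
          B s * (x ^ Set.ncard {c | c ∈ I ∧ ¬ cube c ⊆ e.1.1} * y ^ Set.ncard {c | c ∈ I ∧ ¬ cube c ⊆ Z'ᶜ}) := by
        refine Finset.sum_le_sum fun s _ => Finset.sum_le_sum fun e he => ?_
        have he' : e.1.2 = Z'ᶜ := by
          rw [Finset.mem_filter] at he
          rw [← he.2, compl_compl]
        have := hrow s e
        rw [he'] at this
        exact this
    _ = ∑ s : SeqOfRecord F ν τ.M g p.K k, B s * y ^ Set.ncard {c | c ∈ I ∧ ¬ cube c ⊆ Z'ᶜ} *
          ∑ e ∈ Finset.univ.filter (fun e : Seq.ExtPair (DOfRecord F ν τ.M g p.K) k s => (e.1.2)ᶜ = Z'),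
            x ^ Set.ncard {c | c ∈ I ∧ ¬ cube c ⊆ e.1.1} := by
        refine Finset.sum_congr rfl fun s _ => ?_
        rw [Finset.mul_sum]
        refine Finset.sum_congr rfl fun e _ => ?_
        ring
    _ ≤ ∑ s : SeqOfRecord F ν τ.M g p.K k, B s * y ^ Set.ncard {c | c ∈ I ∧ ¬ cube c ⊆ Z'ᶜ} * Real.exp (x * I.card) :=
        Finset.sum_le_sum fun s _ => mul_le_mul_of_nonneg_left (hcount s) (mul_nonneg (hB s) hyZ)
    _ = (∑ s : SeqOfRecord F ν τ.M g p.K k, B s) * Real.exp (x * I.card) * y ^ Set.ncard {c | c ∈ I ∧ ¬ cube c ⊆ Z'ᶜ} := by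
        rw [Finset.sum_mul, Finset.sum_mul]
        refine Finset.sum_congr rfl fun s _ => ?_
        ring

end Tower

/-! ## §3. AT K1⁷'s RECORD: the piece step at the ₁₃ plugs (`w`-rows from `Provisos₁₃CoPH`), the regrouping, (U1_Z) at level k+1, and the feed to F1 -/

section AtRecord

variable (F : T4Family) (N : ℕ) [NeZero N]
variable (θ : Stage13HParams F N) (P : B12.RunParams)

/-- The `w`-rows of S1's piece step AT THE RECORD: along the run `P`, for `k < K`, def-T's step provisos FROM `Provisos₁₃CoPH` (`h.tstep`: joint measurability `measW` restricted to
the section `V′` by `Measurable.of_uncurry_left`, and `absW_le`).  Bookkeeping. [cite: Balaban1988Convergent, (3.2)–(3.9) pp.265–266, (3.24)–(3.25) p.270 (bookkeeping)] -/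
theorem measurable_w₁₃_section_and_abs_le (h : θ.Provisos₁₃CoPH F N) (k : ℕ) (hk : k < P.K)
    (s' : SeqOfRecord F θ.ν θ.τ9.M (gOfRecord₁₃ F N θ.toStage13Params P) P.K (k + 1)) (V' : GaugeField (F.P P.K) (k + 1) (SU N)) :
    (Measurable fun U : GaugeField (F.P P.K) k (SU N) =>
        wOfRecord₉ F N θ.toStage9Params P (gOfRecord₁₃ F N θ.toStage13Params P) k s' U V') ∧
      ∀ U, |wOfRecord₉ F N θ.toStage9Params P (gOfRecord₁₃ F N θ.toStage13Params P) k s' U V'| ≤ 1 :=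
  ⟨Measurable.of_uncurry_left
      (f := fun (V'' : GaugeField (F.P P.K) (k + 1) (SU N)) (U : GaugeField (F.P P.K) k (SU N)) =>
        wOfRecord₉ F N θ.toStage9Params P (gOfRecord₁₃ F N θ.toStage13Params P) k s' U V'')
      ((h.tstep P k hk).measW s'),
    fun U => (h.tstep P k hk).absW_le s' U V'⟩

open Classical in
/-- **★ THE (0.2)-CURRENCY PIECE STEP AT THE ₁₃ PLUGS** (hand-out item (i)): S1's generic `abs_pieceOfRecord_succ_le` at `ν := θ.ν`, `τ := θ.τ9`, `E := EOfRecord₁₃`,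
`w := wOfRecord₉`, `ppSel := θ.ppSel`, `g := gOfRecord₁₃`, the `w`-rows DISCHARGED by `Provisos₁₃CoPH.tstep` (`k < K`): for a bounded measurable majorant `M(s)` of the level-`k`
history terms of `densOfRecord₁₃` and the 𝐑-ratio row with modulus `c_R ≥ 0` at level `k+1`,
`|ρ_{k+1}(Z′,V′)| ≤ Σ_{s′ : Λ_{k+1}(s′)ᶜ = Z′} χ_{k+1}(s′)(V′)·c_R(s′)(V′)·T_k(|w_k(s′)(·,V′)|·M(init s′))(V′)`.  The 𝐑-ratio row is DISPLAYED ([IV] (0.3)); nothing of Bałaban's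
asserted. [cite: Balaban1989LargeFieldI, (0.2)–(0.3) p.176; Balaban1988Convergent, (3.1) p.264, (3.24)–(3.25) p.270] -/
theorem abs_pieceOfRecord₁₃_succ_le (h : θ.Provisos₁₃CoPH F N) (k : ℕ) (hk : k < P.K) (Z' : Set (Site (F.P P.K) 0))
    (V' : GaugeField (F.P P.K) (k + 1) (SU N))
    (M : SeqOfRecord F θ.ν θ.τ9.M (gOfRecord₁₃ F N θ.toStage13Params P) P.K k → GaugeField (F.P P.K) k (SU N) → ℝ)
    (cR : SeqOfRecord F θ.ν θ.τ9.M (gOfRecord₁₃ F N θ.toStage13Params P) P.K (k + 1) → GaugeField (F.P P.K) (k + 1) (SU N) → ℝ)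
    (hM : ∀ s U, |chiSeqOfRecord F N θ.ν θ.τ9.M (gOfRecord₁₃ F N θ.toStage13Params P) P.K k s U *
        slotsOfRecord F N θ.ν θ.τ9 (EOfRecord₁₃ F N θ.toStage13Params) (wOfRecord₉ F N θ.toStage9Params) θ.ppSel P
          (gOfRecord₁₃ F N θ.toStage13Params P) k s U| ≤ M s U)
    (hMm : ∀ s, Measurable (M s)) (hMC : ∀ s, ∃ C : ℝ, ∀ U, M s U ≤ C)
    (hcR : ∀ s', 0 ≤ cR s' V')
    (hR : ∀ s', |slotsOfRecord F N θ.ν θ.τ9 (EOfRecord₁₃ F N θ.toStage13Params) (wOfRecord₉ F N θ.toStage9Params) θ.ppSel P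
          (gOfRecord₁₃ F N θ.toStage13Params P) (k + 1) s' V'| ≤
        cR s' V' * |slotsTOfRecord F N θ.ν θ.τ9 (EOfRecord₁₃ F N θ.toStage13Params) (wOfRecord₉ F N θ.toStage9Params) θ.ppSel P
          (gOfRecord₁₃ F N θ.toStage13Params P) (k + 1) s' V'|) :
    |pieceOfRecord F N θ.ν θ.τ9.M
        (slotsOfRecord F N θ.ν θ.τ9 (EOfRecord₁₃ F N θ.toStage13Params) (wOfRecord₉ F N θ.toStage9Params) θ.ppSel)
        P (gOfRecord₁₃ F N θ.toStage13Params P) (k + 1) Z' V'|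
      ≤ ∑ s' ∈ Finset.univ.filter
          (fun s' : SeqOfRecord F θ.ν θ.τ9.M (gOfRecord₁₃ F N θ.toStage13Params P) P.K (k + 1) => (s'.Λ (k + 1))ᶜ = Z'),
          chiSeqOfRecord F N θ.ν θ.τ9.M (gOfRecord₁₃ F N θ.toStage13Params P) P.K (k + 1) s' V' * cR s' V' *
            transportOfRecord F N P.K k
              (fun U => |wOfRecord₉ F N θ.toStage9Params P (gOfRecord₁₃ F N θ.toStage13Params P) k s' U V'| * M s'.init U) V' :=
  abs_pieceOfRecord_succ_le F N θ.ν θ.τ9 (EOfRecord₁₃ F N θ.toStage13Params) (wOfRecord₉ F N θ.toStage9Params) θ.ppSel P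
    (gOfRecord₁₃ F N θ.toStage13Params P) k Z' V' M cR hM hMm hMC
    (fun s' => (measurable_w₁₃_section_and_abs_le F N θ P h k hk s' V').1)
    (fun s' U => (measurable_w₁₃_section_and_abs_le F N θ P h k hk s' V').2 U) hcR hR

open Classical in
/-- **THE PIECE STEP AT THE ₁₃ PLUGS, REGROUPED BY NEW PAIRS** (hand-out item (ii)): the same bound indexed by the old history `s` and the new admissible pair `e = (Ω_{k+1}, Λ_{k+1})`
with `Λ_{k+1}ᶜ = Z′` (`Seq.sum_seq_succ`; the pairs' `Fintype` structures are an instance binder, dischargeable by `Seq.extPairFintype`).  Nothing of Bałaban's asserted.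
[cite: Balaban1989LargeFieldI, (0.2)–(0.3) p.176; Balaban1988Convergent, §3 p.267, p.270] -/
theorem abs_pieceOfRecord₁₃_succ_le_sum_extPair (h : θ.Provisos₁₃CoPH F N) (k : ℕ) (hk : k < P.K) (Z' : Set (Site (F.P P.K) 0))
    (V' : GaugeField (F.P P.K) (k + 1) (SU N))
    [∀ s : SeqOfRecord F θ.ν θ.τ9.M (gOfRecord₁₃ F N θ.toStage13Params P) P.K k,
      Fintype (Seq.ExtPair (DOfRecord F θ.ν θ.τ9.M (gOfRecord₁₃ F N θ.toStage13Params P) P.K) k s)]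
    (M : SeqOfRecord F θ.ν θ.τ9.M (gOfRecord₁₃ F N θ.toStage13Params P) P.K k → GaugeField (F.P P.K) k (SU N) → ℝ)
    (cR : SeqOfRecord F θ.ν θ.τ9.M (gOfRecord₁₃ F N θ.toStage13Params P) P.K (k + 1) → GaugeField (F.P P.K) (k + 1) (SU N) → ℝ)
    (hM : ∀ s U, |chiSeqOfRecord F N θ.ν θ.τ9.M (gOfRecord₁₃ F N θ.toStage13Params P) P.K k s U *
        slotsOfRecord F N θ.ν θ.τ9 (EOfRecord₁₃ F N θ.toStage13Params) (wOfRecord₉ F N θ.toStage9Params) θ.ppSel P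
          (gOfRecord₁₃ F N θ.toStage13Params P) k s U| ≤ M s U)
    (hMm : ∀ s, Measurable (M s)) (hMC : ∀ s, ∃ C : ℝ, ∀ U, M s U ≤ C)
    (hcR : ∀ s', 0 ≤ cR s' V')
    (hR : ∀ s', |slotsOfRecord F N θ.ν θ.τ9 (EOfRecord₁₃ F N θ.toStage13Params) (wOfRecord₉ F N θ.toStage9Params) θ.ppSel P
          (gOfRecord₁₃ F N θ.toStage13Params P) (k + 1) s' V'| ≤
        cR s' V' * |slotsTOfRecord F N θ.ν θ.τ9 (EOfRecord₁₃ F N θ.toStage13Params) (wOfRecord₉ F N θ.toStage9Params) θ.ppSel P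
          (gOfRecord₁₃ F N θ.toStage13Params P) (k + 1) s' V'|) :
    |pieceOfRecord F N θ.ν θ.τ9.M
        (slotsOfRecord F N θ.ν θ.τ9 (EOfRecord₁₃ F N θ.toStage13Params) (wOfRecord₉ F N θ.toStage9Params) θ.ppSel)
        P (gOfRecord₁₃ F N θ.toStage13Params P) (k + 1) Z' V'|
      ≤ ∑ s : SeqOfRecord F θ.ν θ.τ9.M (gOfRecord₁₃ F N θ.toStage13Params P) P.K k, ∑ e ∈ Finset.univ.filter
          (fun e : Seq.ExtPair (DOfRecord F θ.ν θ.τ9.M (gOfRecord₁₃ F N θ.toStage13Params P) P.K) k s => (e.1.2)ᶜ = Z'),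
          chiSeqOfRecord F N θ.ν θ.τ9.M (gOfRecord₁₃ F N θ.toStage13Params P) P.K (k + 1) (s.snoc e) V' * cR (s.snoc e) V' *
            transportOfRecord F N P.K k
              (fun U => |wOfRecord₉ F N θ.toStage9Params P (gOfRecord₁₃ F N θ.toStage13Params P) k (s.snoc e) U V'| * M s U) V' :=
  abs_pieceOfRecord_succ_le_sum_extPair F N θ.ν θ.τ9 (EOfRecord₁₃ F N θ.toStage13Params) (wOfRecord₉ F N θ.toStage9Params) θ.ppSel P
    (gOfRecord₁₃ F N θ.toStage13Params P) k Z' V' M cR hM hMm hMC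
    (fun s' => (measurable_w₁₃_section_and_abs_le F N θ P h k hk s' V').1)
    (fun s' U => (measurable_w₁₃_section_and_abs_le F N θ P h k hk s' V').2 U) hcR hR

open Classical in
/-- **★★★ (U1_Z) AT LEVEL k+1 AT K1⁷'s RECORD FROM A LEVEL-k TOTAL MAJORANT MASS + THE NEW-PAIR ROW** (hand-out item (iii)): along the run `P`, `k < K`, with the `w`-rows from
`Provisos₁₃CoPH`, a bounded measurable majorant `M(s)` of the level-`k` history terms, the 𝐑-ratio row (modulus `c_R ≥ 0`) and the PRODUCT-SHAPE NEW-PAIR ROW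
«`χ_{k+1}(s.snoc e)(V′)·c_R(s.snoc e)(V′)·T_k(|w_k(s.snoc e)(·,V′)|·M(s))(V′) ≤ B(s)·x^{#𝐃_{k+1}-cubes ⊄ Ω_{k+1}}·y^{#𝐃_{k+1}-cubes ⊄ Λ_{k+1}}`» (`x, y ≥ 0`, `B ≥ 0`), every piece of
`ρ_{k+1}` of record obeys `|ρ_{k+1}(Z′,V′)| ≤ (Σ_s B(s))·exp(x·|I_{k+1}|)·y^{#𝐃_{k+1}-cubes ⊄ Z′ᶜ}` — F1's per-last-region shape at level `k+1` with `e^{a} := (Σ_s B s)·exp(x|I_{k+1}|)`.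
The new-pair row is DISPLAYED analytic content ([III] §3 ∕ (2.49), [IV] §1, [B16] (1.89)) — LOCATED, nobody's theorem here; the total-mass letter `B` is the consumer's level-`k` input;
nothing of Bałaban's asserted. [cite: Balaban1989LargeFieldI, (0.2)–(0.3) p.176; Balaban1988Convergent, (2.49) p.264, §3 p.267, (3.25) p.270; Balaban1989LargeFieldII, (1.89) p.387] -/
theorem abs_pieceOfRecord₁₃_succ_le_of_totalMass_of_newPairRow (h : θ.Provisos₁₃CoPH F N) (k : ℕ) (hk : k < P.K) (Z' : Set (Site (F.P P.K) 0))
    (V' : GaugeField (F.P P.K) (k + 1) (SU N))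
    (M : SeqOfRecord F θ.ν θ.τ9.M (gOfRecord₁₃ F N θ.toStage13Params P) P.K k → GaugeField (F.P P.K) k (SU N) → ℝ)
    (cR : SeqOfRecord F θ.ν θ.τ9.M (gOfRecord₁₃ F N θ.toStage13Params P) P.K (k + 1) → GaugeField (F.P P.K) (k + 1) (SU N) → ℝ)
    (hM : ∀ s U, |chiSeqOfRecord F N θ.ν θ.τ9.M (gOfRecord₁₃ F N θ.toStage13Params P) P.K k s U *
        slotsOfRecord F N θ.ν θ.τ9 (EOfRecord₁₃ F N θ.toStage13Params) (wOfRecord₉ F N θ.toStage9Params) θ.ppSel P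
          (gOfRecord₁₃ F N θ.toStage13Params P) k s U| ≤ M s U)
    (hMm : ∀ s, Measurable (M s)) (hMC : ∀ s, ∃ C : ℝ, ∀ U, M s U ≤ C)
    (hcR : ∀ s', 0 ≤ cR s' V')
    (hR : ∀ s', |slotsOfRecord F N θ.ν θ.τ9 (EOfRecord₁₃ F N θ.toStage13Params) (wOfRecord₉ F N θ.toStage9Params) θ.ppSel P
          (gOfRecord₁₃ F N θ.toStage13Params P) (k + 1) s' V'| ≤
        cR s' V' * |slotsTOfRecord F N θ.ν θ.τ9 (EOfRecord₁₃ F N θ.toStage13Params) (wOfRecord₉ F N θ.toStage9Params) θ.ppSel P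
          (gOfRecord₁₃ F N θ.toStage13Params P) (k + 1) s' V'|)
    (B : SeqOfRecord F θ.ν θ.τ9.M (gOfRecord₁₃ F N θ.toStage13Params P) P.K k → ℝ) (hB : ∀ s, 0 ≤ B s) {x y : ℝ} (hx : 0 ≤ x) (hy : 0 ≤ y)
    (hrow : ∀ (s : SeqOfRecord F θ.ν θ.τ9.M (gOfRecord₁₃ F N θ.toStage13Params P) P.K k)
        (e : Seq.ExtPair (DOfRecord F θ.ν θ.τ9.M (gOfRecord₁₃ F N θ.toStage13Params P) P.K) k s),
      chiSeqOfRecord F N θ.ν θ.τ9.M (gOfRecord₁₃ F N θ.toStage13Params P) P.K (k + 1) (s.snoc e) V' * cR (s.snoc e) V' *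
          transportOfRecord F N P.K k
            (fun U => |wOfRecord₉ F N θ.toStage9Params P (gOfRecord₁₃ F N θ.toStage13Params P) k (s.snoc e) U V'| * M s U) V' ≤
        B s * (x ^ Set.ncard {c | c ∈ cubeIndices (F.P P.K) (dCubeSide (F.P P.K).L θ.τ9.M
              (RkOfRecord (F.P P.K).L θ.ν.r (gOfRecord₁₃ F N θ.toStage13Params P (k + 1))) (k + 1)) ∧
            ¬ cubeEnl (F.P P.K) (dCubeSide (F.P P.K).L θ.τ9.M (RkOfRecord (F.P P.K).L θ.ν.r (gOfRecord₁₃ F N θ.toStage13Params P (k + 1))) (k + 1)) c 0 ⊆ e.1.1} *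
          y ^ Set.ncard {c | c ∈ cubeIndices (F.P P.K) (dCubeSide (F.P P.K).L θ.τ9.M
              (RkOfRecord (F.P P.K).L θ.ν.r (gOfRecord₁₃ F N θ.toStage13Params P (k + 1))) (k + 1)) ∧
            ¬ cubeEnl (F.P P.K) (dCubeSide (F.P P.K).L θ.τ9.M (RkOfRecord (F.P P.K).L θ.ν.r (gOfRecord₁₃ F N θ.toStage13Params P (k + 1))) (k + 1)) c 0 ⊆ e.1.2})) :
    |pieceOfRecord F N θ.ν θ.τ9.M
        (slotsOfRecord F N θ.ν θ.τ9 (EOfRecord₁₃ F N θ.toStage13Params) (wOfRecord₉ F N θ.toStage9Params) θ.ppSel)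
        P (gOfRecord₁₃ F N θ.toStage13Params P) (k + 1) Z' V'|
      ≤ (∑ s : SeqOfRecord F θ.ν θ.τ9.M (gOfRecord₁₃ F N θ.toStage13Params P) P.K k, B s) *
          Real.exp (x * (cubeIndices (F.P P.K) (dCubeSide (F.P P.K).L θ.τ9.M
            (RkOfRecord (F.P P.K).L θ.ν.r (gOfRecord₁₃ F N θ.toStage13Params P (k + 1))) (k + 1))).card) *
          y ^ Set.ncard {c | c ∈ cubeIndices (F.P P.K) (dCubeSide (F.P P.K).L θ.τ9.M
              (RkOfRecord (F.P P.K).L θ.ν.r (gOfRecord₁₃ F N θ.toStage13Params P (k + 1))) (k + 1)) ∧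
            ¬ cubeEnl (F.P P.K) (dCubeSide (F.P P.K).L θ.τ9.M (RkOfRecord (F.P P.K).L θ.ν.r (gOfRecord₁₃ F N θ.toStage13Params P (k + 1))) (k + 1)) c 0 ⊆ Z'ᶜ} :=
  abs_pieceOfRecord_succ_le_of_totalMass_of_newPairRow F N θ.ν θ.τ9 (EOfRecord₁₃ F N θ.toStage13Params) (wOfRecord₉ F N θ.toStage9Params) θ.ppSel P
    (gOfRecord₁₃ F N θ.toStage13Params P) k Z' V' M cR hM hMm hMC
    (fun s' => (measurable_w₁₃_section_and_abs_le F N θ P h k hk s' V').1)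
    (fun s' U => (measurable_w₁₃_section_and_abs_le F N θ P h k hk s' V').2 U) hcR hR B hB hx hy hrow

open Classical in
/-- **★★★ THE FEED TO F1: THE UPPER HALF OF (0.1) AT LEVEL k+1 FROM A LEVEL-k TOTAL MAJORANT MASS + THE NEW-PAIR ROWS** (`densOfRecord₁₃_le_of_pieceBound` with its (U1_Z) binder
DISCHARGED by `abs_pieceOfRecord₁₃_succ_le_of_totalMass_of_newPairRow` at every `Z′`, `V′`): if, for every coarse field `V′`, the level-`k` majorants, the 𝐑-ratio rows and the
new-pair rows hold with `V′`-INDEPENDENT letters `B ≥ 0`, `x, y ≥ 0`, and the two NUMERIC clauses «`(Σ_s B s)·exp(x·|I_{k+1}|) ≤ e^{a}`» (the total mass and the `Ω_{k+1}`-count fit the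
volume rate) and «`a + y·|I_{k+1}| ≤ E₊·|T₁^{(k+1)}|`» hold, then `ρ_{k+1}(V′) ≤ exp(E₊|T₁^{(k+1)}|)` at every configuration.  CONDITIONAL on the displayed rows; (U1) NOT proved;
[III] Cor. 3 NOT proved; nothing of Bałaban's asserted. [cite: Balaban1988Convergent, Cor. 3 (2.50) p.264, §3 p.267, (3.25) p.270; Balaban1989LargeFieldI, (0.2)–(0.3) p.176; Balaban1989LargeFieldII, (0.1) pp.355–356, (1.89) p.387] -/
theorem densOfRecord₁₃_succ_le_of_totalMass_of_newPairRow (h : θ.Provisos₁₃CoPH F N) (k : ℕ) (hk : k < P.K)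
    (M : SeqOfRecord F θ.ν θ.τ9.M (gOfRecord₁₃ F N θ.toStage13Params P) P.K k → GaugeField (F.P P.K) k (SU N) → ℝ)
    (cR : SeqOfRecord F θ.ν θ.τ9.M (gOfRecord₁₃ F N θ.toStage13Params P) P.K (k + 1) → GaugeField (F.P P.K) (k + 1) (SU N) → ℝ)
    (hM : ∀ s U, |chiSeqOfRecord F N θ.ν θ.τ9.M (gOfRecord₁₃ F N θ.toStage13Params P) P.K k s U *
        slotsOfRecord F N θ.ν θ.τ9 (EOfRecord₁₃ F N θ.toStage13Params) (wOfRecord₉ F N θ.toStage9Params) θ.ppSel P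
          (gOfRecord₁₃ F N θ.toStage13Params P) k s U| ≤ M s U)
    (hMm : ∀ s, Measurable (M s)) (hMC : ∀ s, ∃ C : ℝ, ∀ U, M s U ≤ C)
    (hcR : ∀ s' V', 0 ≤ cR s' V')
    (hR : ∀ s' V', |slotsOfRecord F N θ.ν θ.τ9 (EOfRecord₁₃ F N θ.toStage13Params) (wOfRecord₉ F N θ.toStage9Params) θ.ppSel P
          (gOfRecord₁₃ F N θ.toStage13Params P) (k + 1) s' V'| ≤
        cR s' V' * |slotsTOfRecord F N θ.ν θ.τ9 (EOfRecord₁₃ F N θ.toStage13Params) (wOfRecord₉ F N θ.toStage9Params) θ.ppSel P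
          (gOfRecord₁₃ F N θ.toStage13Params P) (k + 1) s' V'|)
    (B : SeqOfRecord F θ.ν θ.τ9.M (gOfRecord₁₃ F N θ.toStage13Params P) P.K k → ℝ) (hB : ∀ s, 0 ≤ B s) {x y : ℝ} (hx : 0 ≤ x) (hy : 0 ≤ y)
    (a Ep : ℝ)
    (hrow : ∀ (V' : GaugeField (F.P P.K) (k + 1) (SU N)) (s : SeqOfRecord F θ.ν θ.τ9.M (gOfRecord₁₃ F N θ.toStage13Params P) P.K k)
        (e : Seq.ExtPair (DOfRecord F θ.ν θ.τ9.M (gOfRecord₁₃ F N θ.toStage13Params P) P.K) k s),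
      chiSeqOfRecord F N θ.ν θ.τ9.M (gOfRecord₁₃ F N θ.toStage13Params P) P.K (k + 1) (s.snoc e) V' * cR (s.snoc e) V' *
          transportOfRecord F N P.K k
            (fun U => |wOfRecord₉ F N θ.toStage9Params P (gOfRecord₁₃ F N θ.toStage13Params P) k (s.snoc e) U V'| * M s U) V' ≤
        B s * (x ^ Set.ncard {c | c ∈ cubeIndices (F.P P.K) (dCubeSide (F.P P.K).L θ.τ9.M
              (RkOfRecord (F.P P.K).L θ.ν.r (gOfRecord₁₃ F N θ.toStage13Params P (k + 1))) (k + 1)) ∧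
            ¬ cubeEnl (F.P P.K) (dCubeSide (F.P P.K).L θ.τ9.M (RkOfRecord (F.P P.K).L θ.ν.r (gOfRecord₁₃ F N θ.toStage13Params P (k + 1))) (k + 1)) c 0 ⊆ e.1.1} *
          y ^ Set.ncard {c | c ∈ cubeIndices (F.P P.K) (dCubeSide (F.P P.K).L θ.τ9.M
              (RkOfRecord (F.P P.K).L θ.ν.r (gOfRecord₁₃ F N θ.toStage13Params P (k + 1))) (k + 1)) ∧
            ¬ cubeEnl (F.P P.K) (dCubeSide (F.P P.K).L θ.τ9.M (RkOfRecord (F.P P.K).L θ.ν.r (gOfRecord₁₃ F N θ.toStage13Params P (k + 1))) (k + 1)) c 0 ⊆ e.1.2}))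
    (hmass : (∑ s : SeqOfRecord F θ.ν θ.τ9.M (gOfRecord₁₃ F N θ.toStage13Params P) P.K k, B s) *
        Real.exp (x * (cubeIndices (F.P P.K) (dCubeSide (F.P P.K).L θ.τ9.M
          (RkOfRecord (F.P P.K).L θ.ν.r (gOfRecord₁₃ F N θ.toStage13Params P (k + 1))) (k + 1))).card) ≤ Real.exp a)
    (hnum : a + y * (cubeIndices (F.P P.K) (dCubeSide (F.P P.K).L θ.τ9.M
        (RkOfRecord (F.P P.K).L θ.ν.r (gOfRecord₁₃ F N θ.toStage13Params P (k + 1))) (k + 1))).card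
        ≤ Ep * (Fintype.card (Site (F.P P.K) (k + 1)) : ℝ)) :
    ∀ V' : GaugeField (F.P P.K) (k + 1) (SU N),
      densOfRecord₁₃ F N θ.toStage13Params P (k + 1) V' ≤ Real.exp (Ep * (Fintype.card (Site (F.P P.K) (k + 1)) : ℝ)) := by
  refine densOfRecord₁₃_le_of_pieceBound F N θ P (k + 1) hy a Ep (fun Z' _ V' => ?_) hnum
  have hyZ : 0 ≤ y ^ Set.ncard {c | c ∈ cubeIndices (F.P P.K) (dCubeSide (F.P P.K).L θ.τ9.M
              (RkOfRecord (F.P P.K).L θ.ν.r (gOfRecord₁₃ F N θ.toStage13Params P (k + 1))) (k + 1)) ∧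
            ¬ cubeEnl (F.P P.K) (dCubeSide (F.P P.K).L θ.τ9.M (RkOfRecord (F.P P.K).L θ.ν.r (gOfRecord₁₃ F N θ.toStage13Params P (k + 1))) (k + 1)) c 0 ⊆ Z'ᶜ} :=
    pow_nonneg hy _
  refine (le_abs_self _).trans ((abs_pieceOfRecord₁₃_succ_le_of_totalMass_of_newPairRow F N θ P h k hk Z' V' M cR hM hMm hMC
    (fun s' => hcR s' V') (fun s' => hR s' V') B hB hx hy (hrow V')).trans ?_)
  exact mul_le_mul_of_nonneg_right hmass hyZ

end AtRecord

end Summit.QuantumFields.YangMills.BalabanUVNodes.N13U1StepPieceCountAtRecord13CoPH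

end
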